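import Summits.BirchSwinnertonDyer.Rank1Residual.X2.RankZero
import Literature.NumberTheory.EllipticCurves.Rank1Residual.ClassX1KellerYinRankOneReduction
import Literature.NumberTheory.EllipticCurves.Rank1Residual.GVParityTwistProofs
import Literature.NumberTheory.EllipticCurves.RootNumberTwistProofs
import Literature.NumberTheory.EllipticCurves.SzpiroLocalDataProofs
import Literature.NumberTheory.DiophantineGeometry.EllArithGlue
import Literature.NumberTheory.DiophantineGeometry.LocalReductionFiniteBadPlacesProofs
import Literature.NumberTheory.DiophantineGeometry.LocalReductionProofs
import HarnessLib

/-!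
# Class X2, rank `1` (sub-cell X2c): the typed anticyclotomic display at `p ‖ N`, and the reduction
# "X2 ∩ {r = 1} ⇐ display + X2 ∩ {r = 0} at the same prime" (cell `b2b-bsdres`, unit `b2b-bsdres-eisenstein-p2`)

HONEST FRAMING (run/shared/lean/b2b/bsd-rank1-residual/, verbatim in every file): the goal of the
cell is to DELETE the COMBINATION-SHAPED residual classes of the Birch–Swinnerton-Dyer formula for
ALL analytic-rank `≤ 1` elliptic curves over `ℚ` — "full BSD formula for every rank `≤ 1` curve in
class `C`" assembled STRICTLY from published theorems — so that the rank-`≤ 1` remainder becomes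
exactly the CONSTRUCTION-SHAPED classes, which are TYPED (missing-input `Prop`s), NOT attempted.
This is not "finishing BSD". Research routes; no claim beyond stated classes.

Sub-cell X2c (`CellC W p := r_an = 1 ∧ ClassX2 W p`, 373 ‖ 705 census pairs) is CONSTRUCTION-
SHAPED. This file SHARPENS its typed input from "the whole `p`-part" (`MissingInputC = MissingPPartAt`)
to the ANTICYCLOTOMIC side only, exactly as the cell did for X1 with Keller–Yin's display
(`Rank1Residual/ClassX1KellerYin*.lean`, x1a): the Castella–Grossi–Lee–Skinner rank-one assembly
(Invent. Math. 227 (2022) Thm. 5.3.1, display (5.7): choose an imaginary quadratic `K` with `d_K`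
odd `< -4`, every prime of `N` split — here INCLUDING `p`, since `p ‖ N` —, `L(E^K,1) ≠ 0`; then
`ord_p(L'(E,1)/(Ω·Reg·∏c)) − ord_p #Ш + 2 ord_p #E(ℚ)_tors = −(same for E^K in rank 0)`) needs at
a multiplicative Eisenstein prime: the anticyclotomic main conjecture at `p ‖ N` (Keller–Yin
arXiv:2402.12781v2 Thm. 5.0.4 — PREPRINT, stated in `Λ^ur`), an anticyclotomic control theorem at a
multiplicative prime allowing torsion, and the Gross–Zagier / BDP–Castella bookkeeping at `p ‖ N`
— NONE assembled in print (Keller–Yin p. 4: "our Main Conjecture would yield a rank 1 BSD formula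
provided the results in [CGS] are extended"). That display is TYPED here as `X2.RankOneDisplay`
(a `Prop`, nothing asserted, NOT an announced theorem). Given it, the rank-one half of X2 reduces to
the rank-zero half AT THE SAME PRIME, because the twist `E^K` has the same reduction type at `p`
(`p` split in `K`: `hasMultiplicativeReductionAtPrime_of_smul_eq_quadraticTwist`, proved here),
reducible `E^K[p]`, analytic rank `0`, and the OPPOSITE Greenberg–Vatsal parity
(`Rank1Residual.gvPar_of_not_gvPar_of_twist`, x1a): so for the 567 ‖ … pairs of X2c with `¬GVPar`
(ψ even) the partner lies in the CLOSED sub-cell X2a (`X2/RankZero.lean`), and only the display is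
missing (`bsdp_of_cellC_of_not_gvPar_of_rankOneDisplay`); in general the partner is a rank-`0` X2
pair and `targetC_of_rankOneDisplay_of_targetB` needs sub-cell X2b's input as well.

Contents (definitions + theorems; nothing asserted):
* `X2.RankOneDisplay` — the typed anticyclotomic display at a multiplicative Eisenstein prime
  (shape of `KellerYin2024.thm421_rankOne_display_OPEN` with "good" replaced by "multiplicative").
* `hasMultiplicativeReductionAtPrime_of_smul_eq_quadraticTwist` — multiplicative reduction at an
  odd `p ∤ d` is preserved by the quadratic twist by `d` (Silverman VII.5.1(b): `c₄ ↦ d²c₄`,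
  `Δ ↦ d⁶Δ`; proved from the tree's local-reduction API).
* `classX2_twist`, `pPartRankZero_twist_of_not_gvPar`, `pPartRankZero_twist_of_rankZero` — the partner.
* `bsdp_of_cellC_of_rankOneDisplay` (generic assembly, adapted from x1a's
  `bsdp_of_classX1_of_analyticRank_eq_one_of_KY_OPEN`), `bsdp_of_cellC_of_not_gvPar_of_rankOneDisplay`,
  `targetC_of_rankOneDisplay_of_targetB`, `target_of_published_of_missingInputB_of_rankOneDisplay`.

References: Castella–Grossi–Lee–Skinner, Invent. Math. 227 (2022) §5 [CastellaEtAl2021]; Keller–Yin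
arXiv:2402.12781v2 §5, p. 4 [KellerYin2024, PRE]; Greenberg–Vatsal 2000 [GreenbergVatsal2000];
Silverman AEC VII.5.1, X.5.4 [SilvermanAEC2009]; Gross–Zagier 1986 Thm. I.7.3; Bump–Friedberg–
Hoffstein / Hoffstein–Luo 1997 (non-vanishing twists); Miller 2011 Def. 1.1 [Miller2011LMS].
-/

set_option autoImplicit false

noncomputable section

open scoped Classical MatrixGroups ModularForm

open CongruenceSubgroup WeierstrassCurve Literature.NumberTheory.EllipticCurves
  Literature.NumberTheory.EllipticCurves.ModularForms Literature.NumberTheory.QuadraticFields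
  Literature.NumberTheory.EllipticCurves.Rank1Residual
  Literature.NumberTheory.EllipticCurves.Rank1Residual.Typed
  Literature.NumberTheory.EllipticCurves.GreenbergVatsal2000
  Literature.NumberTheory.EllipticCurves.Wuthrich2014
  Literature.NumberTheory.EllipticCurves.SteinWuthrich2013
  IsDedekindDomain NumberField Rat.HeightOneSpectrum

namespace Summit.BirchSwinnertonDyer.Rank1Residual.X2

/-! ### The typed anticyclotomic display at a multiplicative Eisenstein prime -/

/-- **TYPED MISSING INPUT of sub-cell X2c (rank one) — the anticyclotomic display at `p ‖ N`.** For
`E/ℚ` (globally minimal `W`), `p ≠ 2` of MULTIPLICATIVE reduction with `E[p]` reducible and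
`ord_{s=1} L(E,s) = 1`, every imaginary quadratic `K` with `d_K` odd `< -4` in which every prime of
`N_E` splits (so `p` splits) and `L(E^K,1) ≠ 0`, every globally minimal model `Wd` of `E^{(d_K)}`,
and the rationals `q = L'(E,1)/(Ω_E·Reg)`, `qd = L(E^K,1)/Ω_{E^K}`:
`ord_p q − (ord_p #Ш(E) + ord_p ∏c_ℓ(E) − 2 ord_p #E(ℚ)_tors) = −(ord_p qd − (same for E^K))` —
display (5.7) of Castella–Grossi–Lee–Skinner 2022 / Keller–Yin p. 22, whose printed derivations
assume GOOD reduction at `p`. At `p ‖ N` it would follow from the anticyclotomic main conjecture of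
Keller–Yin Thm. 5.0.4 (PREPRINT) + a control theorem at a multiplicative prime + GZ/BDP bookkeeping,
not assembled anywhere. A `Prop`; nothing asserted; NOT an announced theorem.
[cite: CastellaEtAl2021, Thm. 5.3.1 and (5.5)–(5.7) (shape only; nothing asserted)] -/
def RankOneDisplay : Prop :=
  ∀ (W : WeierstrassCurve ℚ) [W.IsElliptic] [W.IsGloballyMinimal] (p : ℕ) [Fact p.Prime],
    p ≠ 2 → W.HasMultiplicativeReductionAtPrime p → ¬ W.HasIrreducibleModPGaloisRep p →
      W.analyticRank = 1 →
    ∀ (K : Type) [Field K] [NumberField K], IsImaginaryQuadratic K →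
      Odd (NumberField.discr K) → NumberField.discr K < -4 →
      SatisfiesHeegnerHypothesis (W.conductorNorm ℤ) K → SatisfiesHeegnerHypothesis p K →
      (W.quadraticTwist (NumberField.discr K : ℚ)).entireLFunction 1 ≠ 0 →
    ∀ (Wd : WeierstrassCurve ℚ) [Wd.IsElliptic] [Wd.IsGloballyMinimal],
      (∃ C : VariableChange ℚ, C • Wd = W.quadraticTwist (NumberField.discr K : ℚ)) →
    ∀ (q qd : ℚ), W.leadingLCoeff / ((W.realPeriodRat * W.regulator : ℝ) : ℂ) = (q : ℂ) →
      Wd.entireLFunction 1 / (Wd.realPeriodRat : ℂ) = (qd : ℂ) →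
      padicValRat p q - ((padicValNat p W.shaOrder : ℤ) + padicValNat p W.tamagawaProduct -
          2 * padicValNat p W.torsionOrder) =
        -(padicValRat p qd - ((padicValNat p Wd.shaOrder : ℤ) + padicValNat p Wd.tamagawaProduct -
          2 * padicValNat p Wd.torsionOrder))

/-! ### Multiplicative reduction is preserved by a twist unramified at `p` -/

/-- **A quadratic twist by `d` with `p ∤ 2d` preserves multiplicative reduction at `p`.** For
`W/ℚ` globally minimal elliptic with multiplicative reduction at the odd prime `p ∤ d` and a model
`W'` of `E^{(d)}` (`C • W' = W.quadraticTwist d`): `W'` has multiplicative reduction at `p`. Proof: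
at the place `v` over `p`, `W` is `v`-minimal with `v(Δ) > 0`, `v(c₄) = 0`; the twisted equation has
`c₄' = d²c₄`, `Δ' = d⁶Δ` and `v`-integral coefficients `d b₂/4, d² b₄/2, d³ b₆/4`, so it is
`v`-minimal (`v(c₄') = 0`) of multiplicative type; multiplicative reduction is an isomorphism
invariant. [cite: SilvermanAEC2009, VII.5 Prop. 5.1(b) and X.5 Cor. 5.4] -/
theorem hasMultiplicativeReductionAtPrime_of_smul_eq_quadraticTwist (W W' : WeierstrassCurve ℚ)
    [W.IsElliptic] [W.IsGloballyMinimal] [W'.IsElliptic] {d : ℤ}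
    {C : VariableChange ℚ} (hC : C • W' = W.quadraticTwist (d : ℚ)) (p : ℕ) [Fact p.Prime]
    (hp2 : p ≠ 2) (hpd : ¬ (p : ℤ) ∣ d) (hW : W.HasMultiplicativeReductionAtPrime p) :
    W'.HasMultiplicativeReductionAtPrime p := by
  have hpP : p.Prime := Fact.out
  have hpZ : Prime (p : ℤ) := Nat.prime_iff_prime_int.mp hpP
  have hp2' : ¬ (p : ℤ) ∣ 2 := fun h =>
    hp2 ((Nat.prime_dvd_prime_iff_eq hpP Nat.prime_two).mp (Int.natCast_dvd_natCast.mp h))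
  obtain ⟨v, rfl⟩ : ∃ v : HeightOneSpectrum (𝓞 ℚ), ((primesEquiv v : ℕ)) = p :=
    ⟨primesEquiv.symm ⟨p, Fact.out⟩, by rw [Equiv.apply_symm_apply]⟩
  have hp4 : ¬ ((primesEquiv v : ℕ) : ℤ) ∣ 4 := fun h =>
    (hpZ.dvd_or_dvd (show ((primesEquiv v : ℕ) : ℤ) ∣ 2 * 2 by norm_num; exact h)).elim hp2' hp2'
  -- `W` is `v`-minimal of multiplicative type: `v(Δ) < 1`, `v(c₄) = 1`
  have hWv : W.HasMultiplicativeReductionAt v :=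
    (W.hasMultiplicativeReductionAtPrime_iff_hasMultiplicativeReductionAt_ringOfIntegers v).mp hW
  have hWmin : W.IsMinimalAt v := IsGloballyMinimal.isMinimalAt W v
  obtain ⟨hvΔ, hvc₄⟩ := (hasMultiplicativeReductionAt_iff_of_isMinimalAt (W := W) (v := v) hWmin).mp hWv
  -- integrality of the coefficients of `W`
  set M : WeierstrassCurve ℤ := integralModelInt W with hM
  have hWM : M.map (Int.castRingHom ℚ) = W := map_integralModelInt W
  have hWb₂ : W.b₂ = (M.b₂ : ℚ) := by
    rw [← congrArg WeierstrassCurve.b₂ hWM, map_b₂, eq_intCast]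
  have hWb₄ : W.b₄ = (M.b₄ : ℚ) := by
    rw [← congrArg WeierstrassCurve.b₄ hWM, map_b₄, eq_intCast]
  have hWb₆ : W.b₆ = (M.b₆ : ℚ) := by
    rw [← congrArg WeierstrassCurve.b₆ hWM, map_b₆, eq_intCast]
  have hv4 : v.valuation ℚ (4 : ℚ) = 1 := by
    have h := valuation_ringOfIntegers_intCast_eq_one v (n := 4) (by exact_mod_cast hp4)
    simpa using h
  have hv2 : v.valuation ℚ (2 : ℚ) = 1 := by
    have h := valuation_ringOfIntegers_intCast_eq_one v (n := 2) (by exact_mod_cast hp2')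
    simpa using h
  have hvd : v.valuation ℚ (d : ℚ) = 1 := valuation_ringOfIntegers_intCast_eq_one v hpd
  have hvb₂ : v.valuation ℚ W.b₂ ≤ 1 := hWb₂ ▸ valuation_ringOfIntegers_intCast_le_one v _
  have hvb₄ : v.valuation ℚ W.b₄ ≤ 1 := hWb₄ ▸ valuation_ringOfIntegers_intCast_le_one v _
  have hvb₆ : v.valuation ℚ W.b₆ ≤ 1 := hWb₆ ▸ valuation_ringOfIntegers_intCast_le_one v _
  -- the twisted equation
  set X : WeierstrassCurve ℚ := W.quadraticTwist (d : ℚ) with hXdef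
  haveI : X.IsElliptic := by rw [← hC]; infer_instance
  have hXint : X.IsIntegralAt v := by
    refine isIntegralAt_of_valuation_le_one (W := X) (v := v) ?_ ?_ ?_ ?_ ?_
    · simp [hXdef]
    · simp only [hXdef, quadraticTwist_a₂, map_div₀, map_mul, hv4, hvd, div_one, one_mul]
      exact hvb₂
    · simp [hXdef]
    · simp only [hXdef, quadraticTwist_a₄, map_div₀, map_mul, map_pow, hv2, hvd, div_one,
        one_mul, one_pow]
      exact hvb₄
    · simp only [hXdef, quadraticTwist_a₆, map_div₀, map_mul, map_pow, hv4, hvd, div_one,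
        one_mul, one_pow]
      exact hvb₆
  have hXc₄ : v.valuation ℚ X.c₄ = 1 := by
    simp only [hXdef, quadraticTwist_c₄, map_mul, map_pow, hvd, one_pow, one_mul, hvc₄]
  have hXΔ : v.valuation ℚ X.Δ < 1 := by
    simp only [hXdef, quadraticTwist_Δ, map_mul, map_pow, hvd, one_pow, one_mul]
    exact hvΔ
  have hXmin : X.IsMinimalAt v := isMinimalAt_of_valuation_c₄_eq_one hXint hXc₄
  have hXmult : X.HasMultiplicativeReductionAt v :=
    (hasMultiplicativeReductionAt_iff_of_isMinimalAt hXmin).mpr ⟨hXΔ, hXc₄⟩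
  have hW'v : W'.HasMultiplicativeReductionAt v := by
    rw [← hasMultiplicativeReductionAt_smul_iff_holds v W' C, hC]
    exact hXmult
  exact (W'.hasMultiplicativeReductionAtPrime_iff_hasMultiplicativeReductionAt_ringOfIntegers v).mpr
    hW'v

/-! ### The partner `E^K` -/

/-- **The twist of an X2 pair by an admissible discriminant is an X2 pair**: for `K` imaginary
quadratic with `d_K` odd and `p` split in `K`, a globally minimal model `Wd` of `E^{(d_K)}` is in
class X2 at `p` (odd `p`, `E^K[p]` reducible — `not_hasIrreducibleModPGaloisRep_twist` —, multiplicative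
reduction at `p` — `hasMultiplicativeReductionAtPrime_of_smul_eq_quadraticTwist`).
[cite: SilvermanAEC2009, VII.5 Prop. 5.1(b) and X.5 Cor. 5.4] -/
theorem classX2_twist (W : WeierstrassCurve ℚ) [W.IsElliptic] [W.IsGloballyMinimal] (p : ℕ)
    [Fact p.Prime] (hX : ClassX2 W p)
    (K : Type) [Field K] [NumberField K] (hK : IsImaginaryQuadratic K)
    (hsplit : SatisfiesHeegnerHypothesis p K)
    (Wd : WeierstrassCurve ℚ) [Wd.IsElliptic] [Wd.IsGloballyMinimal]
    (hWd : ∃ C : VariableChange ℚ, C • Wd = W.quadraticTwist (NumberField.discr K : ℚ)) :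
    ClassX2 Wd p := by
  have hp : p.Prime := Fact.out
  obtain ⟨hp2, hred, hmult⟩ := hX
  obtain ⟨C, hC⟩ := hWd
  have hdneg : NumberField.discr K < 0 := IsImaginaryQuadratic.discr_neg hK
  have hd0 : (NumberField.discr K : ℚ) ≠ 0 := by exact_mod_cast hdneg.ne
  have hpd : ¬ (p : ℤ) ∣ NumberField.discr K := not_dvd_discr_of_split hK hp hp2 hsplit
  exact ⟨hp2, not_hasIrreducibleModPGaloisRep_twist hred hd0 Wd C hC,
    hasMultiplicativeReductionAtPrime_of_smul_eq_quadraticTwist W Wd hC p hp2 hpd hmult⟩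

/-- **The partner shape from `BSD(·,p)` on the rank-zero half of X2 at the same prime**: if
`BSD(E',p)` holds for every rank-`0` X2 pair `(E',p)`, then for a rank-one X2 pair `(E,p)` and an
admissible `K` the twist `E^K` (analytic rank `0`, class X2 by `classX2_twist`) has the rank-`0`
print shape `PPartRankZero` (converses `pPart_of_bsdp`, `pPartRankZero_of_pPart`).
[cite: CastellaEtAl2021, proof of Thm. 5.3.1] [cite: Miller2011LMS, Def. 1.1] -/
theorem pPartRankZero_twist_of_rankZero (hmod : hasEntireLFunction_rat)
    (hGZK : rank_eq_analyticRank_of_analyticRank_le_one)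
    (W : WeierstrassCurve ℚ) [W.IsElliptic] [W.IsGloballyMinimal] (p : ℕ) [Fact p.Prime]
    (hX : ClassX2 W p)
    (h0 : ∀ (W' : WeierstrassCurve ℚ) [W'.IsElliptic] [W'.IsGloballyMinimal],
      ClassX2 W' p → W'.analyticRank = 0 → BSDp W' p)
    (K : Type) [Field K] [NumberField K] (hK : IsImaginaryQuadratic K)
    (hsplit : SatisfiesHeegnerHypothesis p K)
    (Wd : WeierstrassCurve ℚ) [Wd.IsElliptic] [Wd.IsGloballyMinimal]
    (hWd : ∃ C : VariableChange ℚ, C • Wd = W.quadraticTwist (NumberField.discr K : ℚ))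
    (hrd : Wd.analyticRank = 0) : PPartRankZero Wd p :=
  pPartRankZero_of_pPart hGZK Wd p hrd
    (pPart_of_bsdp hmod hGZK Wd p (by omega)
      (h0 Wd (classX2_twist W p hX K hK hsplit Wd hWd) hrd))

/-- **The partner of a `¬GVPar` pair lies in the CLOSED sub-cell X2a.** For a rank-one X2 pair
`(E,p)` with `¬ GVPar W p` (ψ even) and an admissible `K`, the twist `E^K` is a rank-`0` X2 pair WITH
the Greenberg–Vatsal parity (`gvPar_of_not_gvPar_of_twist`: an odd twist unramified at `p` swaps the
parity types), so its rank-`0` print shape follows from the PUBLISHED facts of `X2/RankZero.lean`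
(`bsdp_of_classX2_of_gvPar_of_analyticRank_eq_zero`). [cite: CastellaEtAl2021, proof of Thm. 5.3.1 (last paragraph)]
[cite: GreenbergVatsal2000, Thm. (1.3) with pp. 1, 14–15] -/
theorem pPartRankZero_twist_of_not_gvPar (hGV : lambdaMu_multiplicative_of_gvPar)
    (hWu : thm16_charIdeal_dvd_multiplicative_of_reducible)
    (hJs : thm61_splitMultiplicative) (hJn : thm61_nonsplitMultiplicative)
    (hHs : exists_isSplitMultCanonical) (hHn : exists_isMultCanonical)
    (hGZK : rank_eq_analyticRank_of_analyticRank_le_one) (hmod : hasEntireLFunction_rat)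
    (hpar : nonempty_modularParametrizationData)
    (hGS : ∀ (W : WeierstrassCurve ℚ) [W.IsElliptic] [W.IsGloballyMinimal] (p : ℕ) [Fact p.Prime],
      greenberg_stevens (W := W) (p := p))
    (W : WeierstrassCurve ℚ) [W.IsElliptic] [W.IsGloballyMinimal] (p : ℕ) [Fact p.Prime]
    (hX : ClassX2 W p) (hnot : ¬ GVPar W p)
    (K : Type) [Field K] [NumberField K] (hK : IsImaginaryQuadratic K)
    (hsplit : SatisfiesHeegnerHypothesis p K)
    (Wd : WeierstrassCurve ℚ) [Wd.IsElliptic] [Wd.IsGloballyMinimal]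
    (hWd : ∃ C : VariableChange ℚ, C • Wd = W.quadraticTwist (NumberField.discr K : ℚ))
    (hrd : Wd.analyticRank = 0) : PPartRankZero Wd p := by
  have hp : p.Prime := Fact.out
  obtain ⟨C, hC⟩ := hWd
  have hdneg : NumberField.discr K < 0 := IsImaginaryQuadratic.discr_neg hK
  have hpd : ¬ (p : ℤ) ∣ NumberField.discr K := not_dvd_discr_of_split hK hp hX.1 hsplit
  have hXd : ClassX2 Wd p := classX2_twist W p hX K hK hsplit Wd ⟨C, hC⟩
  have hgv : GVPar Wd p :=
    gvPar_of_not_gvPar_of_twist (W := W) (p := p) hX.1 hX.2.1 hnot hdneg hpd Wd C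
      (by simpa using hC)
  exact pPartRankZero_of_pPart hGZK Wd p hrd
    (pPart_of_bsdp hmod hGZK Wd p (by omega)
      (bsdp_of_classX2_of_gvPar_of_analyticRank_eq_zero hGV hWu hJs hJn hHs hHn hGZK hmod hpar Wd p
        (hGS Wd p) hrd hXd hgv))

/-! ### The assembly: X2 ∩ {r = 1} ⇐ display + partner -/

/-- **X2c ⇒ `BSD(E,p)` modulo the typed display and a partner input** (the assembly of
Castella–Grossi–Lee–Skinner 2022 Thm. 5.3.1 / Keller–Yin p. 22, adapted verbatim from x1a's
`Rank1Residual.bsdp_of_classX1_of_analyticRank_eq_one_of_KY_OPEN` with "good" replaced by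
"multiplicative"): for a rank-one X2 pair, the display (`hdisp`, TYPED — nothing in print) and the
rank-`0` print shape for every admissible twist (`hpartner`) give Miller's `BSD(E,p)`; the auxiliary
field exists by the non-vanishing of quadratic twists (`hHL`, Bump–Friedberg–Hoffstein /
Hoffstein–Luo), `q ∈ ℚ` by Gross–Zagier (`hGZ`), `Ш` finite and `rank = 1` by Kolyvagin (`hGZK`).
[cite: CastellaEtAl2021, Thm. 5.3.1 and (5.5)–(5.7)] [cite: Miller2011LMS, Def. 1.1 and §1] -/
theorem bsdp_of_cellC_of_rankOneDisplay
    (hmod : exists_isNewformOf) (hHL : HoffsteinLuo1997_exists_twist_L_one_ne_zero)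
    (hGZ : GrossZagier1986_thm_I_7_3) (hGZK : rank_eq_analyticRank_of_analyticRank_le_one)
    (hdisp : RankOneDisplay)
    (W : WeierstrassCurve ℚ) [W.IsElliptic] [W.IsGloballyMinimal] (p : ℕ) [Fact p.Prime]
    (hc : CellC W p)
    (hpartner : ∀ (K : Type) [Field K] [NumberField K], IsImaginaryQuadratic K →
        Odd (NumberField.discr K) → NumberField.discr K < -4 →
        SatisfiesHeegnerHypothesis (W.conductorNorm ℤ) K → SatisfiesHeegnerHypothesis p K →
        (W.quadraticTwist (NumberField.discr K : ℚ)).entireLFunction 1 ≠ 0 →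
      ∀ (Wd : WeierstrassCurve ℚ) [Wd.IsElliptic] [Wd.IsGloballyMinimal],
        (∃ C : VariableChange ℚ, C • Wd = W.quadraticTwist (NumberField.discr K : ℚ)) →
        Wd.analyticRank = 0 → PPartRankZero Wd p) :
    BSDp W p := by
  obtain ⟨hr, hp2, hred, hmult⟩ := hc
  -- `w(E) = -1` from `ord_{s=1} L(E,s) = 1`
  have hw : W.rootNumber = -1 := by
    have h := even_analyticRank_iff_rootNumber_eq_one.rootNumber_eq_neg_one_pow (W := W)
      (even_analyticRank_iff_rootNumber_eq_one_of_exists_isNewformOf W hmod)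
    rw [hr, pow_one] at h
    exact h
  -- the admissible auxiliary field `K` and a global minimal model `Wd` of `E^{(d_K)}`
  obtain ⟨K, _, _, hK, hodd, hlt, hHN, hHp, hLK⟩ :=
    exists_admissibleField_of_rootNumber_eq_neg_one hmod hHL W hw p
  have hd0 : (NumberField.discr K : ℚ) ≠ 0 := by
    exact_mod_cast (show NumberField.discr K ≠ 0 by omega)
  obtain ⟨Wd, _, _, C, hC⟩ := exists_isGloballyMinimal_smul_eq_quadraticTwist W hd0
  -- the twist has analytic rank `0`
  have hLd : Wd.entireLFunction 1 ≠ 0 := by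
    rw [← Wd.entireLFunction_smul C, hC]
    exact hLK
  have hrd : Wd.analyticRank = 0 := analyticRank_eq_zero_of_entireLFunction_one_ne_zero hLd
  -- `q = L'(E,1)/(Ω·Reg) ∈ ℚ` (Gross–Zagier), `rank E(ℚ) = 1` (Kolyvagin)
  obtain ⟨hrank, hfin⟩ := hGZK W (by omega)
  have hrk : W.mordellWeilRank = 1 := by omega
  obtain ⟨q, hq0, hqL⟩ := leadingLCoeff_eq_rat_mul_of_analyticRank_eq_one (W := W) hGZ hr hrk
  have hΩ : (0 : ℝ) < W.realPeriodRat := W.realPeriodRat_pos_holds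
  have hR : (0 : ℝ) < W.regulator := W.regulator_pos'
  have hΩR : ((W.realPeriodRat * W.regulator : ℝ) : ℂ) ≠ 0 := by
    exact_mod_cast (mul_pos hΩ hR).ne'
  have hq : W.leadingLCoeff / ((W.realPeriodRat * W.regulator : ℝ) : ℂ) = (q : ℂ) := by
    rw [div_eq_iff hΩR, hqL]
    push_cast
    ring
  -- `qd = L(E^K,1)/Ω_{E^K}` with its valuation (the partner)
  obtain ⟨qd, hqd, hvd⟩ := hpartner K hK hodd hlt hHN hHp hLK Wd ⟨C, hC⟩ hrd
  -- the display
  have hd := hdisp W p hp2 hmult hred hr K hK hodd hlt hHN hHp hLK Wd ⟨C, hC⟩ q qd hq hqd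
  have hv : padicValRat p q = (padicValNat p W.shaOrder : ℤ) + padicValNat p W.tamagawaProduct -
      2 * padicValNat p W.torsionOrder := by
    rw [hvd] at hd
    linarith
  exact bsdp_of_pPart W p (WeierstrassCurve.hasEntireLFunction_rat_of_exists_isNewformOf hmod) hGZK
    (by omega) ⟨q, hq, hv⟩

/-- **X2c ∧ ¬GVPar ⇒ `BSD(E,p)` modulo the typed display ALONE** (published facts otherwise): the
partner lies in the closed sub-cell X2a (`pPartRankZero_twist_of_not_gvPar`). On the census these are
the rank-one X2 pairs with ψ even (567 of 705 below 2·10⁴).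
[cite: CastellaEtAl2021, Thm. 5.3.1] [cite: GreenbergVatsal2000, Thm. (1.3) with pp. 1, 14–15] -/
theorem bsdp_of_cellC_of_not_gvPar_of_rankOneDisplay (hGV : lambdaMu_multiplicative_of_gvPar)
    (hWu : thm16_charIdeal_dvd_multiplicative_of_reducible)
    (hJs : thm61_splitMultiplicative) (hJn : thm61_nonsplitMultiplicative)
    (hHs : exists_isSplitMultCanonical) (hHn : exists_isMultCanonical)
    (hGZK : rank_eq_analyticRank_of_analyticRank_le_one) (hpar : nonempty_modularParametrizationData)
    (hGS : ∀ (W : WeierstrassCurve ℚ) [W.IsElliptic] [W.IsGloballyMinimal] (p : ℕ) [Fact p.Prime],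
      greenberg_stevens (W := W) (p := p))
    (hmod : exists_isNewformOf) (hHL : HoffsteinLuo1997_exists_twist_L_one_ne_zero)
    (hGZ : GrossZagier1986_thm_I_7_3) (hdisp : RankOneDisplay)
    (W : WeierstrassCurve ℚ) [W.IsElliptic] [W.IsGloballyMinimal] (p : ℕ) [Fact p.Prime]
    (hc : CellC W p) (hnot : ¬ GVPar W p) : BSDp W p :=
  bsdp_of_cellC_of_rankOneDisplay hmod hHL hGZ hGZK hdisp W p hc
    (fun K _ _ hK _ _ _ hsplit _ Wd _ _ hWd hrd ↦
      pPartRankZero_twist_of_not_gvPar hGV hWu hJs hJn hHs hHn hGZK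
        (WeierstrassCurve.hasEntireLFunction_rat_of_exists_isNewformOf hmod) hpar hGS W p hc.2 hnot
        K hK hsplit Wd hWd hrd)

/-- **Sub-cell X2c's target from the typed display and the rank-zero half of X2** (sub-cell X2a is
closed, so only X2b's target enters): `RankOneDisplay → TargetB → TargetC`, granted the published
facts. [cite: CastellaEtAl2021, Thm. 5.3.1] [cite: Miller2011LMS, Def. 1.1] -/
theorem targetC_of_rankOneDisplay_of_targetB (hGV : lambdaMu_multiplicative_of_gvPar)
    (hWu : thm16_charIdeal_dvd_multiplicative_of_reducible)
    (hJs : thm61_splitMultiplicative) (hJn : thm61_nonsplitMultiplicative)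
    (hHs : exists_isSplitMultCanonical) (hHn : exists_isMultCanonical)
    (hGZK : rank_eq_analyticRank_of_analyticRank_le_one) (hpar : nonempty_modularParametrizationData)
    (hGS : ∀ (W : WeierstrassCurve ℚ) [W.IsElliptic] [W.IsGloballyMinimal] (p : ℕ) [Fact p.Prime],
      greenberg_stevens (W := W) (p := p))
    (hmod : exists_isNewformOf) (hHL : HoffsteinLuo1997_exists_twist_L_one_ne_zero)
    (hGZ : GrossZagier1986_thm_I_7_3) (hdisp : RankOneDisplay) (hB : TargetB) : TargetC := by
  intro W _ _ p _ hc
  have hmod' := WeierstrassCurve.hasEntireLFunction_rat_of_exists_isNewformOf hmod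
  have h0 : ∀ (W' : WeierstrassCurve ℚ) [W'.IsElliptic] [W'.IsGloballyMinimal],
      ClassX2 W' p → W'.analyticRank = 0 → BSDp W' p := by
    intro W' _ _ hX' hr'
    by_cases hgv : GVPar W' p
    · exact targetA_of_published hGV hWu hJs hJn hHs hHn hGZK hmod' hpar hGS W' p ⟨hr', hX', hgv⟩
    · exact hB W' p ⟨hr', hX', hgv⟩
  exact bsdp_of_cellC_of_rankOneDisplay hmod hHL hGZ hGZK hdisp W p hc
    (fun K _ _ hK _ _ _ hsplit _ Wd _ _ hWd hrd ↦
      pPartRankZero_twist_of_rankZero hmod' hGZK W p hc.2 h0 K hK hsplit Wd hWd hrd)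

/-- **What remains of class X2 after this unit's files, in the kernel**: the statement of record
`X2.Target` follows from the PUBLISHED named facts, Mazur's main conjecture at every sub-cell-X2b
pair (`MissingInputB`, rank `0`, other parity — not in print), and the typed anticyclotomic display
at `p ‖ N` (`RankOneDisplay` — not in print; Keller–Yin Thm. 5.0.4 PRE supplies only its main-
conjecture ingredient). [cite: Miller2011LMS, Def. 1.1 and §1] -/
theorem target_of_published_of_missingInputB_of_rankOneDisplay
    (hGV : lambdaMu_multiplicative_of_gvPar) (hWu : thm16_charIdeal_dvd_multiplicative_of_reducible)
    (hJs : thm61_splitMultiplicative) (hJn : thm61_nonsplitMultiplicative)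
    (hHs : exists_isSplitMultCanonical) (hHn : exists_isMultCanonical)
    (hGZK : rank_eq_analyticRank_of_analyticRank_le_one) (hpar : nonempty_modularParametrizationData)
    (hGS : ∀ (W : WeierstrassCurve ℚ) [W.IsElliptic] [W.IsGloballyMinimal] (p : ℕ) [Fact p.Prime],
      greenberg_stevens (W := W) (p := p))
    (hmod : exists_isNewformOf) (hHL : HoffsteinLuo1997_exists_twist_L_one_ne_zero)
    (hGZ : GrossZagier1986_thm_I_7_3)
    (hmissB : ∀ (W : WeierstrassCurve ℚ) [W.IsElliptic] [W.IsGloballyMinimal] (p : ℕ) [Fact p.Prime],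
      CellB W p → MissingInputB W p)
    (hdisp : RankOneDisplay) : Target :=
  have hmod' := WeierstrassCurve.hasEntireLFunction_rat_of_exists_isNewformOf hmod
  have hB : TargetB := targetB_of_missingInputB hJs hJn hHs hHn hGZK hmod' hpar hGS hmissB
  target_of_targets (targetA_of_published hGV hWu hJs hJn hHs hHn hGZK hmod' hpar hGS) hB
    (targetC_of_rankOneDisplay_of_targetB hGV hWu hJs hJn hHs hHn hGZK hpar hGS hmod hHL hGZ hdisp hB)

end Summit.BirchSwinnertonDyer.Rank1Residual.X2

end
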